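import Summits.Ventures.YMGap.RobustBall.StringTensionOnBall
import Summits.Ventures.YMGap.RobustBall.RobustAreaLawRowsW
import HarnessLib

/-!
# Robust ball (Y2), area-law side — STRING TENSION ON THE TIER-2 BALL (vertical window, no range cut-off)

HONEST FRAMING: venture file of the cell `pub-ymgap` (QuantumFields programme), track ROBUST-BALL, seat rb-p2 (g2).  Strong-coupling LATTICE
statements; nothing about the continuum, a spectral mass gap, or Clay.

WHAT.  The tier-2 twin of `StringTensionOnBall`: ds-4's currency `AreaLawOnBallW N d β κ ε₀ ε₁ mv` (`AreaLawWDefs`; ROBUST-BALL-STATEMENT §6(b)) is a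
volume-uniform torus area law on the DIAMETER-WEIGHTED ball `ClusterDomain κ ε₀ ε₁ ∩ IsSlabLocal mv` (loads weighted `e^{κ diam X}`, infinite
horizontal range, the window only vertical).  By the generic passage `hasAreaLawWith_of_torusBound` it lands in the tree's `ℤ^d` currencies exactly as
the tier-1 law does: ONE pair `(C, c)`, `c > 0`, such that every infinite-volume limit state of every eventually-member family obeys
`HasAreaLawWith μ χ_N C c` and has string tension `≥ c` whenever it exists (`hasAreaLawWith_onBallW`, `stringTension_onBallW`,
`suFundStringTension_ge_onBallW`), with `SU(2)`, `d = 4` instances on ds-4's certified tier-2 rows `(β_W, κ, ε) = (1/3, log 6/5, 1/10)`,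
`(1/8, log 6/5, 27/100)` (`su2_stringTension_onBallW_oneThird_w65`, `…_oneEighth_w65`).
WHAT IS NOT CLAIMED: existence of the string tension for members (no reflection positivity for a generic `W`); anything on the window-free or
centre-invariance-only tier-2 balls (lit-1: `not_areaLawOnBallC`).
-/

noncomputable section

open MeasureTheory Filter Topology
open Literature.MathematicalPhysics.QuantumLattice
open Literature.MathematicalPhysics.QuantumFieldTheory hiding ZdEdge Site
open Literature.Barriers.QuantumFields (suFundStringTension suFundStringTension_def)

namespace Summit.Ventures.YMGap.RobustBall

variable {d N : ℕ}

/-- **AREA LAW ON THE TIER-2 BALL ⇒ `ℤ^d` AREA LAW OF EVERY LIMIT STATE, SAME CONSTANTS.**  If `AreaLawOnBallW N d β κ ε₀ ε₁ mv` (`d ≥ 2`), there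
are `C` and `c > 0` such that for every family whose members lie, for all large torus sizes, in `ClusterDomain κ ε₀ ε₁ ∩ IsSlabLocal mv`, every
`μ ∈ perturbedLimitPoints β 𝓦` satisfies `HasAreaLawWith μ χ_N C c`. [folklore] -/
theorem hasAreaLawWith_onBallW [NeZero d] (hd : 2 ≤ d) {β κ ε₀ ε₁ : ℝ} {mv : ℕ} (h : AreaLawOnBallW N d β κ ε₀ ε₁ mv) :
    ∃ C c : ℝ, 0 < c ∧ ∀ 𝓦 : PerturbationFamily d N,
      (∀ᶠ L : ℕ in atTop, 𝓦 L ∈ ClusterDomain κ ε₀ ε₁ ∧ IsSlabLocal mv (𝓦 L)) →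
        ∀ μ ∈ perturbedLimitPoints β 𝓦,
          HasAreaLawWith μ (fun g => normalisedCharacter N (fundamentalRep (Fin N) g)) C c := by
  obtain ⟨C, c, hc, hA⟩ := h
  refine ⟨C, c, hc, fun 𝓦 h𝓦 μ hμ => hasAreaLawWith_of_torusBound (β := β)
    (fun L => {W | W ∈ ClusterDomain κ ε₀ ε₁ ∧ IsSlabLocal mv W}) (fun L W hW R T hR hT hRL hTL => ?_) 𝓦 h𝓦 hμ⟩
  exact hA (L + 1) W hW.1 hW.2 0 0 1 R T (fin_zero_ne_one_of_two_le hd) hR hT hRL hTL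

/-- **STRING TENSION ON THE TIER-2 BALL.**  Under `AreaLawOnBallW N d β κ ε₀ ε₁ mv` (`d ≥ 2`): ONE pair `(C, c)`, `c > 0`, such that every
infinite-volume limit state of every eventually-member family obeys `HasAreaLawWith μ χ_N C c` (hence `HasAreaLawState`), has string tension
`σ ≥ c` whenever `HasStringTension μ χ_N σ`, and is `IsConfining` as soon as its string tension exists.  Existence of `σ` is NOT asserted.
[folklore] -/
theorem stringTension_onBallW [NeZero d] (hd : 2 ≤ d) {β κ ε₀ ε₁ : ℝ} {mv : ℕ} (h : AreaLawOnBallW N d β κ ε₀ ε₁ mv) :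
    ∃ C c : ℝ, 0 < c ∧ ∀ 𝓦 : PerturbationFamily d N,
      (∀ᶠ L : ℕ in atTop, 𝓦 L ∈ ClusterDomain κ ε₀ ε₁ ∧ IsSlabLocal mv (𝓦 L)) →
        ∀ μ ∈ perturbedLimitPoints β 𝓦,
          HasAreaLawWith μ (fun g => normalisedCharacter N (fundamentalRep (Fin N) g)) C c ∧
          HasAreaLawState μ (fun g => normalisedCharacter N (fundamentalRep (Fin N) g)) ∧
          (∀ σ : ℝ, HasStringTension μ (fun g => normalisedCharacter N (fundamentalRep (Fin N) g)) σ → c ≤ σ) ∧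
          ((∃ σ : ℝ, HasStringTension μ (fun g => normalisedCharacter N (fundamentalRep (Fin N) g)) σ) →
            IsConfining μ (fun g => normalisedCharacter N (fundamentalRep (Fin N) g))) := by
  obtain ⟨C, c, hc, hA⟩ := hasAreaLawWith_onBallW hd h
  refine ⟨C, c, hc, fun 𝓦 h𝓦 μ hμ => ?_⟩
  have hW := hA 𝓦 h𝓦 μ hμ
  exact ⟨hW, ⟨C, c, hc, hW⟩, fun σ hσ => hW.le_of_hasStringTension hσ,
    fun hσ => HasAreaLawState.isConfining ⟨C, c, hc, hW⟩ hσ⟩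

/-- The `d = 4` reading with the tree's named string tension: under `AreaLawOnBallW N 4 β κ ε₀ ε₁ mv`, one `c > 0` bounds from below
`suFundStringTension N μ` for every limit state of every eventually-member family whose string tension exists. [folklore] -/
theorem suFundStringTension_ge_onBallW {β κ ε₀ ε₁ : ℝ} {mv : ℕ} (h : AreaLawOnBallW N 4 β κ ε₀ ε₁ mv) :
    ∃ C c : ℝ, 0 < c ∧ ∀ 𝓦 : PerturbationFamily 4 N,
      (∀ᶠ L : ℕ in atTop, 𝓦 L ∈ ClusterDomain κ ε₀ ε₁ ∧ IsSlabLocal mv (𝓦 L)) →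
        ∀ μ ∈ perturbedLimitPoints β 𝓦,
          HasAreaLawWith μ (fun g => normalisedCharacter N (fundamentalRep (Fin N) g)) C c ∧
          ((∃ σ : ℝ, HasStringTension μ (fun g => normalisedCharacter N (fundamentalRep (Fin N) g)) σ) →
            c ≤ suFundStringTension N μ) := by
  obtain ⟨C, c, hc, hA⟩ := hasAreaLawWith_onBallW (N := N) (by norm_num) h
  refine ⟨C, c, hc, fun 𝓦 h𝓦 μ hμ => ⟨hA 𝓦 h𝓦 μ hμ, fun ⟨σ, hσ⟩ => ?_⟩⟩
  rw [suFundStringTension_def, hσ.stringTension_eq]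
  exact (hA 𝓦 h𝓦 μ hμ).le_of_hasStringTension hσ

/-! ### `SU(2)`, `d = 4`: ds-4's certified tier-2 balls -/

/-- **`SU(2)`, `d = 4`, `β_W = 1/3`, TIER-2 ball `ClusterDomain (log 6/5) (1/5) (1/10)` (window `mv ≥ 1`, NO range cut-off): string tension on the
ball.**  One `c > 0` such that every infinite-volume limit state of every eventually-member family satisfies `HasAreaLawWith μ χ₂ C c` and, whenever its
string tension exists, `c ≤ suFundStringTension 2 μ`.  Input: ds-4's `su2_areaLawOnBallW_oneThird_w65`. [folklore] -/
theorem su2_stringTension_onBallW_oneThird_w65 {mv : ℕ} (hmv : 1 ≤ mv) :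
    ∃ C c : ℝ, 0 < c ∧ ∀ 𝓦 : PerturbationFamily 4 2,
      (∀ᶠ L : ℕ in atTop, 𝓦 L ∈ ClusterDomain (Real.log (6 / 5)) (1 / 5) (1 / 10) ∧ IsSlabLocal mv (𝓦 L)) →
        ∀ μ ∈ perturbedLimitPoints (1 / 6) 𝓦,
          HasAreaLawWith μ (fun g => normalisedCharacter 2 (fundamentalRep (Fin 2) g)) C c ∧
          ((∃ σ : ℝ, HasStringTension μ (fun g => normalisedCharacter 2 (fundamentalRep (Fin 2) g)) σ) →
            c ≤ suFundStringTension 2 μ) :=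
  suFundStringTension_ge_onBallW (su2_areaLawOnBallW_oneThird_w65 hmv)

/-- **`SU(2)`, `d = 4`, `β_W = 1/8`, TIER-2 ball `ClusterDomain (log 6/5) (27/50) (27/100)`**: the same, from ds-4's
`su2_areaLawOnBallW_oneEighth_w65`. [folklore] -/
theorem su2_stringTension_onBallW_oneEighth_w65 {mv : ℕ} (hmv : 1 ≤ mv) :
    ∃ C c : ℝ, 0 < c ∧ ∀ 𝓦 : PerturbationFamily 4 2,
      (∀ᶠ L : ℕ in atTop, 𝓦 L ∈ ClusterDomain (Real.log (6 / 5)) (27 / 50) (27 / 100) ∧ IsSlabLocal mv (𝓦 L)) →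
        ∀ μ ∈ perturbedLimitPoints (1 / 16) 𝓦,
          HasAreaLawWith μ (fun g => normalisedCharacter 2 (fundamentalRep (Fin 2) g)) C c ∧
          ((∃ σ : ℝ, HasStringTension μ (fun g => normalisedCharacter 2 (fundamentalRep (Fin 2) g)) σ) →
            c ≤ suFundStringTension 2 μ) :=
  suFundStringTension_ge_onBallW (su2_areaLawOnBallW_oneEighth_w65 hmv)

/-- **`SU(2)`, `d = 4`, `β_W = 1/2`, TIER-2 ball `ClusterDomain (log 6/5) (7/100) (7/200)`**: the same, from ds-4's
`su2_areaLawOnBallW_oneHalf_w65`. [folklore] -/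
theorem su2_stringTension_onBallW_oneHalf_w65 {mv : ℕ} (hmv : 1 ≤ mv) :
    ∃ C c : ℝ, 0 < c ∧ ∀ 𝓦 : PerturbationFamily 4 2,
      (∀ᶠ L : ℕ in atTop, 𝓦 L ∈ ClusterDomain (Real.log (6 / 5)) (7 / 100) (7 / 200) ∧ IsSlabLocal mv (𝓦 L)) →
        ∀ μ ∈ perturbedLimitPoints (1 / 4) 𝓦,
          HasAreaLawWith μ (fun g => normalisedCharacter 2 (fundamentalRep (Fin 2) g)) C c ∧
          ((∃ σ : ℝ, HasStringTension μ (fun g => normalisedCharacter 2 (fundamentalRep (Fin 2) g)) σ) →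
            c ≤ suFundStringTension 2 μ) :=
  suFundStringTension_ge_onBallW (su2_areaLawOnBallW_oneHalf_w65 hmv)

end Summit.Ventures.YMGap.RobustBall

end
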